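import Mathlib
import Literature.NumberTheory.Sieve.LiouvillePolynomialValuesP54Reduction
import Literature.NumberTheory.Sieve.LiouvillePolynomialValuesProgressionMR
import HarnessLib

/-!
# Teräväinen 2024, Proposition 5.4 for `g = λ` (the core, start-point form)

Support file (everything PROVED; no definitions, no named facts) towards the named fact
`Literature.NumberTheory.Sieve.teravainen2024_cor_2_1` (J. Teräväinen, *On the Liouville function
at polynomial arguments*, Amer. J. Math. 146 (2024) = arXiv:2010.07924, Corollary 2.1 ⊂
Theorem 2.6 for `g_j = λ`, proved in §5). This file completes the proof of

> **Proposition 5.4** (for `g = λ`, `δ = 1/30`). Let `k ≥ 1`, `R₀ ≥ 1`, `B ∈ ℕ`. For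
> `H' ≥ H₀(k, R₀, B)` and `X ≥ X₀(k, R₀, B, H')`, the number of `1 ≤ y ≤ X` such that for SOME
> real polynomial `P` of degree `≤ k` and SOME progression `n ≡ a (mod r)`, `1 ≤ r ≤ R₀`,
> `|∑_{y<n≤y+H', n≡a (r)} λ(n) e(-P(n))| > (1 - 1/30) · #{y<n≤y+H' : n ≡ a (r)}`,
> is at most `X/(log log H')^B`

(`Teravainen2024.liouville_prop54_core`). Relative to the printed Proposition 5.4 this is the
case `g = λ` (so `q = 2` and any `δ < 1 - 2/π` is admissible; we take `δ = 1/30`), with the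
exceptional-set bound `≪ X/log log H` strengthened to `X/(log log H')^B` for every fixed `B`
(free from the proof), the quantifier order `X ≫ H' ≫ R₀` made explicit, and stated for the
starting point `y` of the window (the sub-interval form with `|I| ≥ H/Q` follows for any fixed
finite family of relative positions by translation and a union bound, which is how it is used in
the deduction of Theorem 2.6 via Proposition 5.3).

The proof is that of §5.4, assembled from the previous files: for a bad `y` the progression is
re-parametrised as `n = n₀ + r t`, `0 < t ≤ N'` (file XVII-A); by the Weyl-sum dichotomy of
Green–Tao (file XIII) either all Weyl sums of the re-centred phase are small — impossible by
Case 2 (file XV: Erdős–Turán + Lemma 5.7 + Jensen give correlation `≤ (1 - 1/15) N'`) — or the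
phase is major arc, and then (file XVI, (5.17)) some residue class modulo `q ≤ K₀` on one of `M₁`
pieces carries a large sum of `λ` along a progression modulo `r q` in a short interval, at a
position quantised relative to `y`; by the Matomäki–Radziwiłł bound for `λ` along progressions
in almost all short intervals (file XIV, from MRT 2015 Thm 1.7 + (1.12) via characters, (5.18)–
(5.19)) and Markov's inequality each of the boundedly many parameter tuples accounts for few `y`.

* `Teravainen2024.exists_tuple_of_bad` — bad `y > R₀` ⇒ a parameter tuple with a large
  progression sum;
* `Teravainen2024.perTuple_card_le`, `perTuple_uniform` — Markov + file XIV for one tuple;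
* `Teravainen2024.card_bad_le_of_perTuple` — the union bound over tuples;
* `Teravainen2024.liouville_prop54_core` — **Proposition 5.4 for `λ`**.

## References
* J. Teräväinen, Amer. J. Math. 146 (2024), no. 4, 1115–1167, Proposition 5.4 and §5.4
  (arXiv:2010.07924, pp. 12–15). [Teravainen2024]
* B. Green, T. Tao, Ann. of Math. 175 (2012), Prop. 4.3. [GreenTao2012Nilmanifolds]
* K. Matomäki, M. Radziwiłł, T. Tao, Algebra Number Theory 9 (2015), Thm 1.7, (1.12).
  [MatomakiRadziwillTao2015]
-/

noncomputable section

open Finset Complex Polynomial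

namespace Literature.NumberTheory.Sieve

namespace Teravainen2024

open Literature.NumberTheory.LFunctions Literature.NumberTheory.Sieve.Vinogradov

/-! ### A union bound and the values of `λ` -/

/-- Union bound over a finite family: `#{y ∈ S : ∃ i ∈ I, R i y} ≤ ∑_{i∈I} #{y ∈ S : R i y}`.
[folklore] -/
theorem card_filter_exists_mem_le {ι κ : Type*} [DecidableEq κ] (S : Finset ι) (I : Finset κ)
    (R : κ → ι → Prop) [∀ i y, Decidable (R i y)] :
    #(S.filter fun y => ∃ i ∈ I, R i y) ≤ ∑ i ∈ I, #(S.filter fun y => R i y) := by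
  classical
  have hsub : (S.filter fun y => ∃ i ∈ I, R i y) ⊆ I.biUnion fun i => S.filter fun y => R i y := by
    intro y hy
    rw [Finset.mem_filter] at hy
    obtain ⟨hyS, i, hi, hR⟩ := hy
    rw [Finset.mem_biUnion]
    exact ⟨i, hi, Finset.mem_filter.mpr ⟨hyS, hR⟩⟩
  exact (Finset.card_le_card hsub).trans Finset.card_biUnion_le

/-- `λ(n) ∈ {1, -1}` for `n ≥ 1`. [folklore] -/
theorem liouville_eq_one_or (n : ℕ) (hn : n ≠ 0) :
    ArithmeticFunction.liouville n = 1 ∨ ArithmeticFunction.liouville n = -1 := by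
  rw [ArithmeticFunction.liouville_apply hn]
  exact neg_one_pow_eq_or ℤ _

/-- **A bad starting point produces a large progression sum at a quantised position.**
(Teräväinen 2024, §5.4, both cases, for `g = λ`.) Fix the data of
`exists_large_classSum_of_large_correlation` with the absolute parameters of `endgame_params`
(`δ = 1/30`), `R₀ < y`, `1 ≤ r ≤ R₀`, and suppose `240π k² K₁ ≤ M₁`, `120 M₁ ≤ ⌊H'/R₀⌋ - 1`
(`K₁ = C(8/ε_w²)^A`) and `199999 K₁ ≤ K₀`. If
`(1 - 1/30) #{y<n≤y+H' : n≡a (r)} < |∑_{y<n≤y+H', n≡a (r)} λ(n) e(-P(n))|` for some real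
polynomial `P` of degree `≤ k`, then there are `N' ∈ [⌊H'/r⌋-1, ⌊H'/r⌋+1]`, `s < r`, `1 ≤ q ≤ K₀`,
`j < M₁`, `b < rq` with
`N'/(2M₁q) ≤ |∑_{y'<n≤y'+rL, n≡b (rq)} λ(n)|`, `y' = y - s + r j L`, `L = ⌊N'/M₁⌋`.
[cite: Teravainen2024, §5.4, proof of Proposition 5.4] -/
theorem exists_tuple_of_bad {k A : ℕ} {C : ℝ} (hC : 1 ≤ C)
    (hXIII : ∀ (δ : ℝ) (L : ℕ) (p : ℝ[X]) (J₀ : ℕ), 0 < δ → δ ≤ 1 → p.natDegree ≤ k → 1 ≤ L →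
        (∀ q : ℕ, 1 ≤ q → (q : ℝ) ≤ J₀ * (C * (8 / δ ^ 2) ^ A) →
          ∃ i, 1 ≤ i ∧ i ≤ k ∧ C * (8 / δ ^ 2) ^ A / (L : ℝ) ^ i < distInt (q * p.coeff i)) →
        ∀ j : ℕ, 1 ≤ j → j ≤ J₀ →
          ‖∑ n ∈ Finset.Ioc (0 : ℤ) L, VdC.e (j * p.eval (n : ℝ))‖ < δ * L)
    {R₀ M₁ K₀ H' y : ℕ} (hR₀y : R₀ < y) (hM₁ : 1 ≤ M₁)
    (hM₁big : 240 * Real.pi * (k : ℝ) ^ 2 * (C * (8 / (1e-10 : ℝ) ^ 2) ^ A) ≤ M₁)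
    (hNmin : 120 * M₁ ≤ H' / R₀ - 1)
    (hK₀ : (199999 : ℝ) * (C * (8 / (1e-10 : ℝ) ^ 2) ^ A) ≤ K₀)
    (P : ℝ[X]) (hP : P.natDegree ≤ k) {a r : ℕ} (hr1 : 1 ≤ r) (hrR : r ≤ R₀)
    (hbad : (1 - 1 / 30) * #((Finset.Ioc y (y + H')).filter fun n => n % r = a % r) <
      ‖∑ n ∈ (Finset.Ioc y (y + H')).filter (fun n => n % r = a % r),
        (ArithmeticFunction.liouville : ArithmeticFunction ℂ) n * VdC.e (-P.eval (n : ℝ))‖) :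
    ∃ N' ∈ Finset.Icc (H' / r - 1) (H' / r + 1), ∃ s ∈ Finset.range r, ∃ q ∈ Finset.Icc 1 K₀,
      ∃ j ∈ Finset.range M₁, ∃ b ∈ Finset.range (r * q),
        (N' : ℝ) / (2 * M₁ * q) ≤
          ‖∑ n ∈ (Finset.Ioc (y - s + r * (j * (N' / M₁))) (y - s + r * (j * (N' / M₁)) +
              r * (N' / M₁))).filter (fun n => n % (r * q) = b),
            (ArithmeticFunction.liouville : ArithmeticFunction ℂ) n‖ := by
  obtain ⟨hε', hend⟩ := endgame_params
  have hry : r ≤ y := hrR.trans hR₀y.le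
  -- re-parametrisation data
  obtain ⟨hcard, hH1, hH2⟩ := card_filter_modEq_Ioc_eq hr1 hry a H'
  have hsum := sum_filter_modEq_Ioc_eq_sum_Ioc
    (fun n => (ArithmeticFunction.liouville : ArithmeticFunction ℂ) n * VdC.e (-P.eval (n : ℝ)))
    hr1 hry a H'
  rw [hcard, hsum] at hbad
  set s := (y - a % r) % r with hs
  have hsr : s < r := Nat.mod_lt _ (by omega)
  set n₀ := y - s with hn₀
  set N' := (y + H' - n₀) / r with hN'
  -- `N'` is in range and large
  have hN'1 : H' / r - 1 ≤ N' := by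
    have h1 : H' / r ≤ N' + 1 := by
      apply Nat.div_le_of_le_mul
      nlinarith
    omega
  have hN'2 : N' ≤ H' / r + 1 := by
    have h1 : N' ≤ (H' + r) / r := by
      rw [Nat.le_div_iff_mul_le (by omega)]; nlinarith
    rw [Nat.add_div_right _ (by omega)] at h1
    exact h1
  have hN'R₀ : H' / R₀ - 1 ≤ N' := by
    have : H' / R₀ ≤ H' / r := Nat.div_le_div_left hrR (by omega)
    omega
  have hN'big : 120 * M₁ ≤ N' := hNmin.trans hN'R₀
  have hM₁N : M₁ ≤ N' := by omega
  have hN'pos : 1 ≤ N' := hM₁.trans hM₁N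
  -- the sequence `g(t) = λ(n₀ + r t)`
  set g : ℕ → ℤ := fun t => ArithmeticFunction.liouville (n₀ + r * t) with hg
  have hg1 : ∀ t, ‖((g t : ℤ) : ℂ)‖ ≤ 1 := by
    intro t
    rw [hg]
    have := norm_liouville_complex_le_one (n₀ + r * t)
    rwa [ArithmeticFunction.intCoe_apply] at this
  have hgpm : ∀ t ∈ Finset.Ioc 0 N', g t = 1 ∨ g t = -1 := by
    intro t ht
    rw [Finset.mem_Ioc] at ht
    rw [hg]
    exact liouville_eq_one_or _ (by
      have : 1 ≤ r * t := by nlinarith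
      omega)
  -- the correlation in the form of `exists_large_classSum_of_large_correlation`
  have hbig : (1 - 1 / 30) * N' <
      ‖∑ t ∈ Finset.Ioc 0 N', ((g t : ℤ) : ℂ) * VdC.e (-P.eval ((n₀ : ℝ) + r * (t : ℝ)))‖ := by
    convert hbad using 2
    refine Finset.sum_congr rfl fun t _ => ?_
    rw [hg, ArithmeticFunction.intCoe_apply]
    push_cast
    rfl
  have herr : 2 * Real.pi * (k : ℝ) ^ 2 * (C * (8 / (1e-10 : ℝ) ^ 2) ^ A) * N' / M₁ + M₁ ≤
      1 / 30 / 2 * N' := by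
    have hM₁R : (0 : ℝ) < M₁ := by exact_mod_cast hM₁
    have hN'R : (120 : ℝ) * M₁ ≤ N' := by exact_mod_cast hN'big
    have h1 : 2 * Real.pi * (k : ℝ) ^ 2 * (C * (8 / (1e-10 : ℝ) ^ 2) ^ A) * N' / M₁ ≤ N' / 120 := by
      rw [div_le_div_iff₀ hM₁R (by norm_num)]
      have hN'0 : (0 : ℝ) ≤ N' := by positivity
      nlinarith
    linarith
  obtain ⟨q, hq1, hqle, j, hj, c, hc, hclass⟩ :=
    exists_large_classSum_of_large_correlation hC hXIII (J := 200) (M := 199999) (by norm_num)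
      (εw := 1e-10) (δ := 1 / 30) (by norm_num) (by norm_num) (by norm_num) (by norm_num) hε' hend
      hM₁ hM₁N herr g hg1 hgpm P hP (n₀ : ℝ) (r : ℝ) hbig
  -- the tuple
  have hqK : q ≤ K₀ := by
    have : (q : ℝ) ≤ K₀ := hqle.trans hK₀
    exact_mod_cast this
  rw [Finset.mem_range] at hc
  refine ⟨N', Finset.mem_Icc.mpr ⟨hN'1, hN'2⟩, s, Finset.mem_range.mpr hsr, q,
    Finset.mem_Icc.mpr ⟨hq1, hqK⟩, j, hj, (n₀ + r * c) % (r * q),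
    Finset.mem_range.mpr (Nat.mod_lt _ (by positivity)), ?_⟩
  -- transfer the class sum to a progression sum
  have htrans := sum_classSum_eq_sum_progression
    (fun n => (ArithmeticFunction.liouville : ArithmeticFunction ℂ) n) hr1 q n₀ j (N' / M₁) c
  rw [Nat.mod_eq_of_lt hc] at htrans
  have hclass' : (N' : ℝ) / (2 * M₁ * q) ≤
      ‖∑ t ∈ (Finset.Ioc (j * (N' / M₁)) ((j + 1) * (N' / M₁))).filter (fun t => t % q = c),
        (ArithmeticFunction.liouville : ArithmeticFunction ℂ) (n₀ + r * t)‖ := by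
    convert hclass using 2
    refine Finset.sum_congr rfl fun t _ => ?_
    rw [hg, ArithmeticFunction.intCoe_apply]
  rw [htrans] at hclass'
  exact hclass'

/-! ### Counting the bad starting points for one parameter tuple -/

/-- Markov + injective re-indexing: if `φ` is injective on `S` with `φ(S) ⊆ [0, X')` and `f ≥ 0`,
then `T · #{y ∈ S : T ≤ f(φ(y))} ≤ ∑_{y' < X'} f(y')`. [folklore] -/
theorem mul_card_filter_le_sum_range {S : Finset ℕ} {φ : ℕ → ℕ} (hφ : Set.InjOn φ S) {X' : ℕ}
    (hφX : ∀ y ∈ S, φ y < X') {f : ℕ → ℝ} (hf : ∀ y, 0 ≤ f y) (T : ℝ) :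
    T * #(S.filter fun y => T ≤ f (φ y)) ≤ ∑ y' ∈ Finset.range X', f y' := by
  classical
  refine (card_filter_mul_le_sum S (fun y _ => hf (φ y)) T).trans ?_
  rw [← Finset.sum_image (f := f) (s := S) (g := φ) hφ]
  exact Finset.sum_le_sum_of_subset_of_nonneg (fun y' hy' => by
    rw [Finset.mem_image] at hy'
    obtain ⟨y, hy, rfl⟩ := hy'
    exact Finset.mem_range.mpr (hφX y hy)) fun y _ _ => hf y

/-- **The `L¹` bound for one tuple** (file XIV applied to the windows `(y', y' + rL]`, modulus
`rq`, residue `b`): under the size conditions of Proposition 5.4,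
`∑_{y'<X'} |∑_{y'<n≤y'+rL, n≡b (rq)} λ(n)| ≤ C₁₄ ρ · rL · X' + X'` with
`ρ = log log(rL)/log(rL/(2rq)) + log^{-1/700} X'`.
[cite: Teravainen2024, §5.4, Case 1 (display after (5.19)), for g = λ] -/
theorem sum_progression_le_of_tuple {C₁₄ : ℝ}
    (hXIV : ∀ (m b H X : ℕ), 1 ≤ m → b < m → 16 * m ≤ H → H ≤ X →
      (m : ℝ) * Real.log H ^ (5 : ℝ) ≤ Real.log X ^ (1 / 125 : ℝ) →
      ∑ y ∈ Finset.range X, ‖∑ n ∈ (Finset.Ioc y (y + H)).filter (fun n => n % m = b),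
          (ArithmeticFunction.liouville : ArithmeticFunction ℂ) n‖ ≤
        C₁₄ * (Real.log (Real.log H) / Real.log (H / (2 * m)) + 1 / Real.log X ^ (1 / 700 : ℝ)) *
          H * X + X)
    {R₀ K₀ H' X X' r N' L q b M₁ : ℕ} (hr1 : 1 ≤ r) (hrR : r ≤ R₀) (hq1 : 1 ≤ q) (hqK : q ≤ K₀)
    (hb : b < r * q) (hN'2 : N' ≤ H' / r + 1) (hLN : M₁ * L ≤ N') (hM₁ : 1 ≤ M₁) (hL : 16 * K₀ ≤ L)
    (hX' : X' = X + R₀ * (H' + 2)) (hX2 : 2 ≤ X)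
    (hlev : ((R₀ * K₀ : ℕ) : ℝ) * Real.log ((R₀ * (H' + 1) : ℕ) : ℝ) ^ (5 : ℝ) ≤
      Real.log X ^ (1 / 125 : ℝ)) :
    ∑ y' ∈ Finset.range X', ‖∑ n ∈ (Finset.Ioc y' (y' + r * L)).filter (fun n => n % (r * q) = b),
        (ArithmeticFunction.liouville : ArithmeticFunction ℂ) n‖ ≤
      C₁₄ * (Real.log (Real.log ((r * L : ℕ) : ℝ)) / Real.log (((r * L : ℕ) : ℝ) / (2 * ((r * q : ℕ) : ℝ))) +
        1 / Real.log X' ^ (1 / 700 : ℝ)) * ((r * L : ℕ) : ℝ) * X' + X' := by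
  have hK₀1 : 1 ≤ K₀ := hq1.trans hqK
  have hL16 : 16 ≤ L := le_trans (by omega) hL
  -- size facts
  have hrL : r * L ≤ R₀ * (H' + 1) := by
    have h1 : L ≤ N' := le_trans (Nat.le_mul_of_pos_left L (by omega)) hLN
    have h2 : N' ≤ H' + 1 := hN'2.trans (by have := Nat.div_le_self H' r; omega)
    calc r * L ≤ R₀ * N' := Nat.mul_le_mul hrR h1
      _ ≤ R₀ * (H' + 1) := Nat.mul_le_mul_left R₀ h2
  have hrLX' : r * L ≤ X' := by rw [hX']; nlinarith
  have h16 : 16 * (r * q) ≤ r * L := by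
    have : 16 * q ≤ L := le_trans (by nlinarith) hL
    nlinarith
  have hm1 : 1 ≤ r * q := by nlinarith
  -- the level condition
  have hXX' : X ≤ X' := by rw [hX']; omega
  have hX'R : (2 : ℝ) ≤ X' := by exact_mod_cast hX2.trans hXX'
  have hrL1 : (1 : ℝ) ≤ ((r * L : ℕ) : ℝ) := by exact_mod_cast (show 1 ≤ r * L by nlinarith)
  have hlev' : ((r * q : ℕ) : ℝ) * Real.log ((r * L : ℕ) : ℝ) ^ (5 : ℝ) ≤ Real.log X' ^ (1 / 125 : ℝ) := by
    have h1 : ((r * q : ℕ) : ℝ) ≤ ((R₀ * K₀ : ℕ) : ℝ) := by exact_mod_cast Nat.mul_le_mul hrR hqK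
    have h2 : Real.log ((r * L : ℕ) : ℝ) ≤ Real.log ((R₀ * (H' + 1) : ℕ) : ℝ) :=
      Real.log_le_log (by linarith) (by exact_mod_cast hrL)
    have h3 : Real.log X ^ (1 / 125 : ℝ) ≤ Real.log X' ^ (1 / 125 : ℝ) := by
      apply Real.rpow_le_rpow (Real.log_nonneg (by exact_mod_cast (show 1 ≤ X by omega)))
        (Real.log_le_log (by positivity) (by exact_mod_cast hXX')) (by norm_num)
    have hlog0 : 0 ≤ Real.log ((r * L : ℕ) : ℝ) := Real.log_nonneg hrL1
    calc ((r * q : ℕ) : ℝ) * Real.log ((r * L : ℕ) : ℝ) ^ (5 : ℝ)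
        ≤ ((R₀ * K₀ : ℕ) : ℝ) * Real.log ((R₀ * (H' + 1) : ℕ) : ℝ) ^ (5 : ℝ) :=
          mul_le_mul h1 (Real.rpow_le_rpow hlog0 h2 (by norm_num)) (by positivity) (by positivity)
      _ ≤ Real.log X ^ (1 / 125 : ℝ) := hlev
      _ ≤ Real.log X' ^ (1 / 125 : ℝ) := h3
  have h := hXIV (r * q) b (r * L) X' hm1 hb h16 hrLX' hlev'
  simpa only [Nat.cast_mul] using h

/-- **Per-tuple count.** With `T = N'/(2M₁q)`, `φ(y) = y - s + r j L`, `S = {1 ≤ y ≤ X : R₀ < y}`: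
`#{y ∈ S : T ≤ |∑_{φ(y)<n≤φ(y)+rL, n≡b (rq)} λ(n)|} ≤ 2R₀K₀C₁₄ ρ X' + 2M₁K₀X'/N'`.
[cite: Teravainen2024, §5.4 (the exceptional set of Proposition 5.4), for g = λ] -/
theorem perTuple_card_le {C₁₄ : ℝ} (hC₁₄ : 0 ≤ C₁₄)
    (hXIV : ∀ (m b H X : ℕ), 1 ≤ m → b < m → 16 * m ≤ H → H ≤ X →
      (m : ℝ) * Real.log H ^ (5 : ℝ) ≤ Real.log X ^ (1 / 125 : ℝ) →
      ∑ y ∈ Finset.range X, ‖∑ n ∈ (Finset.Ioc y (y + H)).filter (fun n => n % m = b),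
          (ArithmeticFunction.liouville : ArithmeticFunction ℂ) n‖ ≤
        C₁₄ * (Real.log (Real.log H) / Real.log (H / (2 * m)) + 1 / Real.log X ^ (1 / 700 : ℝ)) *
          H * X + X)
    {R₀ K₀ H' X X' r N' L s q j b M₁ : ℕ} (hr1 : 1 ≤ r) (hrR : r ≤ R₀) (hsr : s < r) (hq1 : 1 ≤ q)
    (hqK : q ≤ K₀) (hj : j < M₁) (hb : b < r * q) (hN'2 : N' ≤ H' / r + 1) (hLdef : L = N' / M₁)
    (hM₁ : 1 ≤ M₁) (hL : 16 * K₀ ≤ L) (hX' : X' = X + R₀ * (H' + 2)) (hX2 : 2 ≤ X)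
    (hlev : ((R₀ * K₀ : ℕ) : ℝ) * Real.log ((R₀ * (H' + 1) : ℕ) : ℝ) ^ (5 : ℝ) ≤
      Real.log X ^ (1 / 125 : ℝ)) :
    (#(((Finset.Icc 1 X).filter fun y => R₀ < y).filter fun y =>
        (N' : ℝ) / (2 * M₁ * q) ≤
          ‖∑ n ∈ (Finset.Ioc (y - s + r * (j * L)) (y - s + r * (j * L) + r * L)).filter
              (fun n => n % (r * q) = b), (ArithmeticFunction.liouville : ArithmeticFunction ℂ) n‖) : ℝ)
      ≤ 2 * R₀ * K₀ * C₁₄ * (Real.log (Real.log ((r * L : ℕ) : ℝ)) /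
            Real.log (((r * L : ℕ) : ℝ) / (2 * ((r * q : ℕ) : ℝ))) + 1 / Real.log X' ^ (1 / 700 : ℝ)) * X' +
        2 * M₁ * K₀ * X' / N' := by
  have hLN : M₁ * L ≤ N' := by rw [hLdef]; exact Nat.mul_div_le N' M₁
  have hK₀1 : 1 ≤ K₀ := hq1.trans hqK
  have hL16 : 16 ≤ L := le_trans (by omega) hL
  have hN'1 : 1 ≤ N' := le_trans (by nlinarith) hLN
  have hN'R : (0 : ℝ) < N' := by exact_mod_cast hN'1
  have hM₁R : (0 : ℝ) < M₁ := by exact_mod_cast hM₁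
  have hqR : (0 : ℝ) < q := by exact_mod_cast hq1
  set T : ℝ := (N' : ℝ) / (2 * M₁ * q) with hT
  have hT0 : 0 < T := by rw [hT]; positivity
  set f : ℕ → ℝ := fun y' => ‖∑ n ∈ (Finset.Ioc y' (y' + r * L)).filter (fun n => n % (r * q) = b),
    (ArithmeticFunction.liouville : ArithmeticFunction ℂ) n‖ with hf
  have hf0 : ∀ y', 0 ≤ f y' := fun y' => norm_nonneg _
  set φ : ℕ → ℕ := fun y => y - s + r * (j * L) with hφ
  set S : Finset ℕ := (Finset.Icc 1 X).filter fun y => R₀ < y with hS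
  have hinj : Set.InjOn φ S := by
    intro y₁ hy₁ y₂ hy₂ h
    rw [hS, Finset.coe_filter, Set.mem_setOf_eq] at hy₁ hy₂
    simp only [hφ] at h
    omega
  have hφX : ∀ y ∈ S, φ y < X' := by
    intro y hy
    rw [hS, Finset.mem_filter, Finset.mem_Icc] at hy
    simp only [hφ]
    have h1 : r * (j * L) ≤ R₀ * (H' + 1) := by
      have : j * L ≤ M₁ * L := Nat.mul_le_mul_right L hj.le
      have h2 : N' ≤ H' + 1 := hN'2.trans (by have := Nat.div_le_self H' r; omega)
      calc r * (j * L) ≤ R₀ * (M₁ * L) := Nat.mul_le_mul hrR this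
        _ ≤ R₀ * (H' + 1) := Nat.mul_le_mul_left R₀ (hLN.trans h2)
    have h3 : R₀ * (H' + 2) = R₀ * (H' + 1) + R₀ := by ring
    have h4 : 1 ≤ R₀ := hr1.trans hrR
    rw [hX', h3]; omega
  have hMarkov := mul_card_filter_le_sum_range hinj hφX hf0 T
  have hsumle := sum_progression_le_of_tuple hXIV hr1 hrR hq1 hqK hb hN'2 hLN hM₁ hL hX' hX2 hlev
  -- `T · # ≤ C₁₄ ρ rL X' + X'`
  set ρ : ℝ := Real.log (Real.log ((r * L : ℕ) : ℝ)) / Real.log (((r * L : ℕ) : ℝ) / (2 * ((r * q : ℕ) : ℝ))) +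
    1 / Real.log X' ^ (1 / 700 : ℝ) with hρ
  have hρ0 : 0 ≤ ρ := by
    have hrL3 : (3 : ℝ) ≤ ((r * L : ℕ) : ℝ) := by exact_mod_cast (show 3 ≤ r * L by nlinarith)
    have hlog1 : 1 ≤ Real.log ((r * L : ℕ) : ℝ) := by
      rw [← Real.log_exp 1]
      exact Real.log_le_log (Real.exp_pos 1) (le_trans Real.exp_one_lt_three.le hrL3)
    have h1 : 0 ≤ Real.log (Real.log ((r * L : ℕ) : ℝ)) := Real.log_nonneg hlog1
    have h2 : 0 < Real.log (((r * L : ℕ) : ℝ) / (2 * ((r * q : ℕ) : ℝ))) := by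
      apply Real.log_pos
      rw [lt_div_iff₀ (by positivity), one_mul]
      have : 2 * (r * q) < r * L := by nlinarith
      exact_mod_cast this
    have hX'1 : (1 : ℝ) < X' := by
      have : 2 ≤ X' := hX2.trans (by rw [hX']; omega)
      exact_mod_cast (show 1 < X' by omega)
    have h3 : 0 < Real.log X' := Real.log_pos hX'1
    rw [hρ]; positivity
  have hmain : T * #(S.filter fun y => T ≤ f (φ y)) ≤ C₁₄ * ρ * ((r * L : ℕ) : ℝ) * X' + X' :=
    hMarkov.trans hsumle
  -- divide by `T` and simplify
  have hX'0 : (0 : ℝ) ≤ X' := by positivity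
  have hcard : (#(S.filter fun y => T ≤ f (φ y)) : ℝ) ≤ (C₁₄ * ρ * ((r * L : ℕ) : ℝ) * X' + X') / T := by
    rw [le_div_iff₀ hT0, mul_comm]; exact hmain
  refine hcard.trans ?_
  rw [hT, div_div_eq_mul_div, div_le_iff₀ hN'R]
  -- `(C₁₄ ρ rL X' + X') 2M₁q ≤ (2R₀K₀C₁₄ρX' + 2M₁K₀X'/N') N'`
  have hLNR : (M₁ : ℝ) * L ≤ N' := by exact_mod_cast hLN
  have hqKR : (q : ℝ) ≤ K₀ := by exact_mod_cast hqK
  have hrRR : (r : ℝ) ≤ R₀ := by exact_mod_cast hrR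
  have e1 : (2 * M₁ * K₀ * X' / N' : ℝ) * N' = 2 * M₁ * K₀ * X' := by field_simp
  simp only [add_mul]
  rw [e1]
  push_cast
  have hA : C₁₄ * ρ * (r * L) * X' * (2 * M₁ * q) ≤ 2 * R₀ * K₀ * C₁₄ * ρ * X' * N' := by
    -- `r ≤ R₀`, `q ≤ K₀`, `M₁ L ≤ N'`
    have h1 : C₁₄ * ρ * (r * L) * X' * (2 * M₁ * q) = 2 * C₁₄ * ρ * X' * (r * q) * (M₁ * L) := by ring
    rw [h1]
    have h2 : (r : ℝ) * q ≤ R₀ * K₀ := mul_le_mul hrRR hqKR (by positivity) (by positivity)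
    have h0 : 0 ≤ 2 * C₁₄ * ρ * X' := by positivity
    calc 2 * C₁₄ * ρ * X' * (r * q) * (M₁ * L) ≤ 2 * C₁₄ * ρ * X' * (R₀ * K₀) * N' :=
          mul_le_mul (mul_le_mul_of_nonneg_left h2 h0) hLNR (by positivity) (by positivity)
      _ = 2 * R₀ * K₀ * C₁₄ * ρ * X' * N' := by ring
  have hB : (X' : ℝ) * (2 * M₁ * q) ≤ 2 * M₁ * K₀ * X' := by
    calc (X' : ℝ) * (2 * M₁ * q) = 2 * M₁ * X' * q := by ring
      _ ≤ 2 * M₁ * X' * K₀ := mul_le_mul_of_nonneg_left hqKR (by positivity)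
      _ = 2 * M₁ * K₀ * X' := by ring
  linarith

/-! ### Uniformising the rate -/

/-- **Uniform rate.** For `1 ≤ r ≤ R₀`, `1 ≤ q ≤ K₀`, `Lmin ≤ L`, `rL ≤ R₀(H'+1)`, `R₀ + 1 ≤ H'`,
`8 ≤ H'`, `16 ≤ L`, `H' ≤ (Lmin/(2K₀))²`, `2 ≤ X ≤ X'`:
`log log(rL)/log(rL/(2rq)) + log^{-1/700} X' ≤ 4 log log H'/log H' + log^{-1/700} X`. [folklore] -/
theorem rate_le_uniform {R₀ K₀ H' X X' r L Lmin q : ℕ} (hr1 : 1 ≤ r) (hq1 : 1 ≤ q)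
    (hqK : q ≤ K₀) (hLmin : Lmin ≤ L) (hrL : r * L ≤ R₀ * (H' + 1)) (hH'R : R₀ + 1 ≤ H')
    (hH'8 : 8 ≤ H') (hL16 : 16 ≤ L) (hsq : (H' : ℝ) ≤ ((Lmin : ℝ) / (2 * K₀)) ^ 2) (hX2 : 2 ≤ X)
    (hXX' : X ≤ X') :
    Real.log (Real.log ((r * L : ℕ) : ℝ)) / Real.log (((r * L : ℕ) : ℝ) / (2 * ((r * q : ℕ) : ℝ))) +
        1 / Real.log X' ^ (1 / 700 : ℝ) ≤
      4 * Real.log (Real.log H') / Real.log H' + 1 / Real.log X ^ (1 / 700 : ℝ) := by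
  have hK₀R : (0 : ℝ) < K₀ := by exact_mod_cast hq1.trans hqK
  have hrR0 : (0 : ℝ) < r := by exact_mod_cast hr1
  have hH'R8 : (8 : ℝ) ≤ H' := by exact_mod_cast hH'8
  have he : Real.exp 1 < 2.7182818286 := Real.exp_one_lt_d9
  -- `log H' ≥ 2`
  have hlogH' : 2 ≤ Real.log H' := by
    rw [Real.le_log_iff_exp_le (by linarith)]
    have : Real.exp 2 = Real.exp 1 * Real.exp 1 := by rw [← Real.exp_add]; norm_num
    nlinarith [Real.exp_pos 1]
  have hllH' : Real.log 2 ≤ Real.log (Real.log H') := Real.log_le_log (by norm_num) hlogH'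
  have hlog2 : (0 : ℝ) < Real.log 2 := Real.log_pos (by norm_num)
  -- `rL ≤ H'^2`
  have hrL2 : ((r * L : ℕ) : ℝ) ≤ (H' : ℝ) ^ 2 := by
    have h1 : r * L ≤ H' * H' := hrL.trans (by nlinarith)
    have : ((r * L : ℕ) : ℝ) ≤ ((H' * H' : ℕ) : ℝ) := by exact_mod_cast h1
    simpa [sq] using this
  have hrL16 : (16 : ℝ) ≤ ((r * L : ℕ) : ℝ) := by exact_mod_cast (show 16 ≤ r * L by nlinarith)
  have hlogRL : Real.log ((r * L : ℕ) : ℝ) ≤ 2 * Real.log H' := by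
    have e : Real.log ((H' : ℝ) ^ 2) = 2 * Real.log H' := by
      rw [Real.log_pow]; push_cast; ring
    rw [← e]
    exact Real.log_le_log (by linarith) hrL2
  have hlogRL1 : 1 ≤ Real.log ((r * L : ℕ) : ℝ) := by
    rw [← Real.log_exp 1]; exact Real.log_le_log (Real.exp_pos 1) (by linarith)
  -- numerator: `log log (rL) ≤ 2 log log H'`
  have hnum : Real.log (Real.log ((r * L : ℕ) : ℝ)) ≤ 2 * Real.log (Real.log H') := by
    calc Real.log (Real.log ((r * L : ℕ) : ℝ)) ≤ Real.log (2 * Real.log H') :=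
          Real.log_le_log (by linarith) hlogRL
      _ = Real.log 2 + Real.log (Real.log H') := by rw [Real.log_mul (by norm_num) (by linarith)]
      _ ≤ 2 * Real.log (Real.log H') := by linarith
  have hnum0 : 0 ≤ Real.log (Real.log ((r * L : ℕ) : ℝ)) := Real.log_nonneg hlogRL1
  -- denominator: `log(rL/(2rq)) = log(L/(2q)) ≥ log(Lmin/(2K₀)) ≥ (log H')/2`
  have hquot : (((r * L : ℕ) : ℝ) / (2 * ((r * q : ℕ) : ℝ))) = (L : ℝ) / (2 * q) := by
    push_cast
    field_simp
  have hLq : (Lmin : ℝ) / (2 * K₀) ≤ (L : ℝ) / (2 * q) := by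
    rw [div_le_div_iff₀ (by positivity) (by positivity)]
    have h1 : (Lmin : ℝ) ≤ L := by exact_mod_cast hLmin
    have h2 : (q : ℝ) ≤ K₀ := by exact_mod_cast hqK
    have := mul_le_mul h1 h2 (by positivity) (by positivity)
    nlinarith
  have hLmin0 : 0 < (Lmin : ℝ) / (2 * K₀) := by
    have h8 : (0 : ℝ) < H' := by linarith
    have : 0 < ((Lmin : ℝ) / (2 * K₀)) ^ 2 := lt_of_lt_of_le h8 hsq
    rcases lt_trichotomy ((Lmin : ℝ) / (2 * K₀)) 0 with h | h | h
    · have : (Lmin : ℝ) / (2 * K₀) ≥ 0 := by positivity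
      linarith
    · rw [h] at this; simp at this
    · exact h
  have hden : Real.log H' / 2 ≤ Real.log (((r * L : ℕ) : ℝ) / (2 * ((r * q : ℕ) : ℝ))) := by
    rw [hquot]
    calc Real.log H' / 2 ≤ Real.log (((Lmin : ℝ) / (2 * K₀)) ^ 2) / 2 :=
          div_le_div_of_nonneg_right (Real.log_le_log (by linarith) hsq) (by norm_num)
      _ = Real.log ((Lmin : ℝ) / (2 * K₀)) := by rw [Real.log_pow]; push_cast; ring
      _ ≤ Real.log ((L : ℝ) / (2 * q)) := Real.log_le_log hLmin0 hLq
  have hden0 : 0 < Real.log H' / 2 := by linarith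
  -- the `X` term
  have hXterm : 1 / Real.log X' ^ (1 / 700 : ℝ) ≤ 1 / Real.log X ^ (1 / 700 : ℝ) := by
    have hX2R : (2 : ℝ) ≤ X := by exact_mod_cast hX2
    have hlogX : 0 < Real.log X := Real.log_pos (by linarith)
    apply one_div_le_one_div_of_le (Real.rpow_pos_of_pos hlogX _)
    exact Real.rpow_le_rpow hlogX.le (Real.log_le_log (by linarith) (by exact_mod_cast hXX'))
      (by norm_num)
  have hfrac : Real.log (Real.log ((r * L : ℕ) : ℝ)) /
      Real.log (((r * L : ℕ) : ℝ) / (2 * ((r * q : ℕ) : ℝ))) ≤ 4 * Real.log (Real.log H') / Real.log H' := by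
    calc Real.log (Real.log ((r * L : ℕ) : ℝ)) / Real.log (((r * L : ℕ) : ℝ) / (2 * ((r * q : ℕ) : ℝ)))
        ≤ (2 * Real.log (Real.log H')) / (Real.log H' / 2) := by
          have hll0 : 0 ≤ 2 * Real.log (Real.log H') := by linarith
          calc Real.log (Real.log ((r * L : ℕ) : ℝ)) /
                Real.log (((r * L : ℕ) : ℝ) / (2 * ((r * q : ℕ) : ℝ)))
              ≤ (2 * Real.log (Real.log H')) /
                  Real.log (((r * L : ℕ) : ℝ) / (2 * ((r * q : ℕ) : ℝ))) :=
                div_le_div_of_nonneg_right hnum (by linarith)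
            _ ≤ (2 * Real.log (Real.log H')) / (Real.log H' / 2) :=
                div_le_div_of_nonneg_left hll0 hden0 hden
      _ = 4 * Real.log (Real.log H') / Real.log H' := by
          field_simp
          ring
  linarith

/-! ### The union bound over parameter tuples -/

open scoped Classical in
/-- **Counting all bad starting points.** Under the hypotheses of `exists_tuple_of_bad`, if every
per-tuple set has at most `U` elements, then the number of bad `y ∈ [1, X]` is at most
`R₀ + 3 R₀³ K₀² M₁ · U`. [cite: Teravainen2024, §5.4 (the exceptional set of Proposition 5.4)] -/
theorem card_bad_le_of_perTuple {k A : ℕ} {C : ℝ} (hC : 1 ≤ C)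
    (hXIII : ∀ (δ : ℝ) (L : ℕ) (p : ℝ[X]) (J₀ : ℕ), 0 < δ → δ ≤ 1 → p.natDegree ≤ k → 1 ≤ L →
        (∀ q : ℕ, 1 ≤ q → (q : ℝ) ≤ J₀ * (C * (8 / δ ^ 2) ^ A) →
          ∃ i, 1 ≤ i ∧ i ≤ k ∧ C * (8 / δ ^ 2) ^ A / (L : ℝ) ^ i < distInt (q * p.coeff i)) →
        ∀ j : ℕ, 1 ≤ j → j ≤ J₀ →
          ‖∑ n ∈ Finset.Ioc (0 : ℤ) L, VdC.e (j * p.eval (n : ℝ))‖ < δ * L)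
    {R₀ M₁ K₀ H' X : ℕ} (hM₁ : 1 ≤ M₁)
    (hM₁big : 240 * Real.pi * (k : ℝ) ^ 2 * (C * (8 / (1e-10 : ℝ) ^ 2) ^ A) ≤ M₁)
    (hNmin : 120 * M₁ ≤ H' / R₀ - 1)
    (hK₀ : (199999 : ℝ) * (C * (8 / (1e-10 : ℝ) ^ 2) ^ A) ≤ K₀)
    {U : ℝ} (hU0 : 0 ≤ U)
    (hU : ∀ (r N' s q j b : ℕ), 1 ≤ r → r ≤ R₀ → N' ∈ Finset.Icc (H' / r - 1) (H' / r + 1) →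
      s < r → 1 ≤ q → q ≤ K₀ → j < M₁ → b < r * q →
      (#(((Finset.Icc 1 X).filter fun y => R₀ < y).filter fun y =>
        (N' : ℝ) / (2 * M₁ * q) ≤
          ‖∑ n ∈ (Finset.Ioc (y - s + r * (j * (N' / M₁))) (y - s + r * (j * (N' / M₁)) +
              r * (N' / M₁))).filter (fun n => n % (r * q) = b),
            (ArithmeticFunction.liouville : ArithmeticFunction ℂ) n‖) : ℝ) ≤ U) :
    (#((Finset.Icc 1 X).filter fun y => ∃ P : ℝ[X], P.natDegree ≤ k ∧ ∃ a r : ℕ, 1 ≤ r ∧ r ≤ R₀ ∧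
        (1 - 1 / 30) * #((Finset.Ioc y (y + H')).filter fun n => n % r = a % r) <
          ‖∑ n ∈ (Finset.Ioc y (y + H')).filter (fun n => n % r = a % r),
            (ArithmeticFunction.liouville : ArithmeticFunction ℂ) n * VdC.e (-P.eval (n : ℝ))‖) : ℝ)
      ≤ R₀ + 3 * (R₀ : ℝ) ^ 3 * (K₀ : ℝ) ^ 2 * M₁ * U := by
  classical
  -- notation
  set Bad : ℕ → Prop := fun y => ∃ P : ℝ[X], P.natDegree ≤ k ∧ ∃ a r : ℕ, 1 ≤ r ∧ r ≤ R₀ ∧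
    (1 - 1 / 30) * #((Finset.Ioc y (y + H')).filter fun n => n % r = a % r) <
      ‖∑ n ∈ (Finset.Ioc y (y + H')).filter (fun n => n % r = a % r),
        (ArithmeticFunction.liouville : ArithmeticFunction ℂ) n * VdC.e (-P.eval (n : ℝ))‖ with hBad
  set Q : ℕ → ℕ → ℕ → ℕ → ℕ → ℕ → ℕ → Prop := fun r N' s q j b y =>
    (N' : ℝ) / (2 * M₁ * q) ≤
      ‖∑ n ∈ (Finset.Ioc (y - s + r * (j * (N' / M₁))) (y - s + r * (j * (N' / M₁)) +
          r * (N' / M₁))).filter (fun n => n % (r * q) = b),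
        (ArithmeticFunction.liouville : ArithmeticFunction ℂ) n‖ with hQ
  set S : Finset ℕ := (Finset.Icc 1 X).filter fun y => R₀ < y with hS
  -- split off `y ≤ R₀`
  have hsplit : #((Finset.Icc 1 X).filter Bad) ≤ R₀ + #(S.filter Bad) := by
    have h1 : (Finset.Icc 1 X).filter Bad ⊆ Finset.Icc 1 R₀ ∪ S.filter Bad := by
      intro y hy
      rw [Finset.mem_filter, Finset.mem_Icc] at hy
      rw [Finset.mem_union, Finset.mem_Icc, hS, Finset.filter_filter, Finset.mem_filter,
        Finset.mem_Icc]
      by_cases h : y ≤ R₀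
      · exact Or.inl ⟨hy.1.1, h⟩
      · exact Or.inr ⟨hy.1, not_le.mp h, hy.2⟩
    calc #((Finset.Icc 1 X).filter Bad) ≤ #(Finset.Icc 1 R₀ ∪ S.filter Bad) := Finset.card_le_card h1
      _ ≤ #(Finset.Icc 1 R₀) + #(S.filter Bad) := Finset.card_union_le _ _
      _ = R₀ + #(S.filter Bad) := by simp
  -- bad `y > R₀` produce tuples
  have htuple : S.filter Bad ⊆ S.filter fun y => ∃ r ∈ Finset.Icc 1 R₀,
      ∃ N' ∈ Finset.Icc (H' / r - 1) (H' / r + 1), ∃ s ∈ Finset.range r, ∃ q ∈ Finset.Icc 1 K₀,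
        ∃ j ∈ Finset.range M₁, ∃ b ∈ Finset.range (r * q), Q r N' s q j b y := by
    intro y hy
    rw [Finset.mem_filter] at hy ⊢
    refine ⟨hy.1, ?_⟩
    have hyR : R₀ < y := by
      have := hy.1; rw [hS, Finset.mem_filter] at this; exact this.2
    obtain ⟨P, hP, a, r, hr1, hrR, hbad⟩ := hy.2
    obtain ⟨N', hN', s, hs, q, hq, j, hj, b, hb, hQy⟩ :=
      exists_tuple_of_bad hC hXIII hyR hM₁ hM₁big hNmin hK₀ P hP hr1 hrR hbad
    exact ⟨r, Finset.mem_Icc.mpr ⟨hr1, hrR⟩, N', hN', s, hs, q, hq, j, hj, b, hb, hQy⟩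
  -- six union bounds
  have h6 : (#(S.filter Bad) : ℝ) ≤ ∑ r ∈ Finset.Icc 1 R₀, ∑ N' ∈ Finset.Icc (H' / r - 1) (H' / r + 1),
      ∑ s ∈ Finset.range r, ∑ q ∈ Finset.Icc 1 K₀, ∑ j ∈ Finset.range M₁, ∑ b ∈ Finset.range (r * q),
        (#(S.filter fun y => Q r N' s q j b y) : ℝ) := by
    have step := (Finset.card_le_card htuple).trans
      (card_filter_exists_mem_le S (Finset.Icc 1 R₀) _)
    refine (Nat.cast_le.mpr step).trans ?_
    push_cast
    refine Finset.sum_le_sum fun r _ => ?_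
    refine (Nat.cast_le.mpr (card_filter_exists_mem_le S _ _)).trans ?_
    push_cast
    refine Finset.sum_le_sum fun N' _ => ?_
    refine (Nat.cast_le.mpr (card_filter_exists_mem_le S _ _)).trans ?_
    push_cast
    refine Finset.sum_le_sum fun s _ => ?_
    refine (Nat.cast_le.mpr (card_filter_exists_mem_le S _ _)).trans ?_
    push_cast
    refine Finset.sum_le_sum fun q _ => ?_
    refine (Nat.cast_le.mpr (card_filter_exists_mem_le S _ _)).trans ?_
    push_cast
    refine Finset.sum_le_sum fun j _ => ?_
    exact_mod_cast card_filter_exists_mem_le S _ _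
  -- bound every term by `U` and count the tuples
  have h7 : ∑ r ∈ Finset.Icc 1 R₀, ∑ N' ∈ Finset.Icc (H' / r - 1) (H' / r + 1),
      ∑ s ∈ Finset.range r, ∑ q ∈ Finset.Icc 1 K₀, ∑ j ∈ Finset.range M₁, ∑ b ∈ Finset.range (r * q),
        (#(S.filter fun y => Q r N' s q j b y) : ℝ) ≤ 3 * (R₀ : ℝ) ^ 3 * (K₀ : ℝ) ^ 2 * M₁ * U := by
    have hK₀R : (0 : ℝ) ≤ K₀ := by positivity
    calc ∑ r ∈ Finset.Icc 1 R₀, ∑ N' ∈ Finset.Icc (H' / r - 1) (H' / r + 1),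
          ∑ s ∈ Finset.range r, ∑ q ∈ Finset.Icc 1 K₀, ∑ j ∈ Finset.range M₁, ∑ b ∈ Finset.range (r * q),
            (#(S.filter fun y => Q r N' s q j b y) : ℝ)
        ≤ ∑ r ∈ Finset.Icc 1 R₀, ∑ _N' ∈ Finset.Icc (H' / r - 1) (H' / r + 1),
          ∑ _s ∈ Finset.range r, ∑ _q ∈ Finset.Icc 1 K₀, ∑ _j ∈ Finset.range M₁, ((R₀ * K₀ : ℕ) : ℝ) * U := by
          refine Finset.sum_le_sum fun r hr => Finset.sum_le_sum fun N' hN' =>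
            Finset.sum_le_sum fun s hs => Finset.sum_le_sum fun q hq => Finset.sum_le_sum fun j hj => ?_
          rw [Finset.mem_Icc] at hr hq
          rw [Finset.mem_range] at hs hj
          calc ∑ b ∈ Finset.range (r * q), (#(S.filter fun y => Q r N' s q j b y) : ℝ)
              ≤ ∑ _b ∈ Finset.range (r * q), U :=
                Finset.sum_le_sum fun b hb => hU r N' s q j b hr.1 hr.2 hN' hs hq.1 hq.2 hj
                  (Finset.mem_range.mp hb)
            _ = ((r * q : ℕ) : ℝ) * U := by rw [Finset.sum_const, Finset.card_range, nsmul_eq_mul]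
            _ ≤ ((R₀ * K₀ : ℕ) : ℝ) * U := by
                apply mul_le_mul_of_nonneg_right _ hU0
                exact_mod_cast Nat.mul_le_mul hr.2 hq.2
      _ ≤ #(Finset.Icc 1 R₀) • ((3 : ℝ) * (R₀ * (K₀ * (M₁ * (((R₀ * K₀ : ℕ) : ℝ) * U))))) := by
          refine Finset.sum_le_card_nsmul _ _ _ fun r hr => ?_
          rw [Finset.mem_Icc] at hr
          simp only [Finset.sum_const, Finset.card_range, Nat.card_Icc, nsmul_eq_mul]
          have hcnt : (((H' / r + 1 + 1 - (H' / r - 1)) : ℕ) : ℝ) ≤ 3 := by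
            have : H' / r + 1 + 1 - (H' / r - 1) ≤ 3 := by omega
            exact_mod_cast this
          have hKI : (((K₀ + 1 - 1 : ℕ)) : ℝ) = K₀ := by simp
          rw [hKI]
          have hrR : (r : ℝ) ≤ R₀ := by exact_mod_cast hr.2
          have h0 : 0 ≤ (K₀ : ℝ) * ((M₁ : ℝ) * (((R₀ * K₀ : ℕ) : ℝ) * U)) := by positivity
          exact mul_le_mul hcnt (mul_le_mul_of_nonneg_right hrR h0) (by positivity) (by norm_num)
      _ = 3 * (R₀ : ℝ) ^ 3 * (K₀ : ℝ) ^ 2 * M₁ * U := by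
          rw [Nat.card_Icc, nsmul_eq_mul]
          have : ((R₀ + 1 - 1 : ℕ) : ℝ) = R₀ := by simp
          rw [this]
          push_cast
          ring
  have hsplitR : (#((Finset.Icc 1 X).filter Bad) : ℝ) ≤ R₀ + #(S.filter Bad) := by exact_mod_cast hsplit
  have hfinal : (#((Finset.Icc 1 X).filter Bad) : ℝ) ≤ R₀ + 3 * (R₀ : ℝ) ^ 3 * (K₀ : ℝ) ^ 2 * M₁ * U := by
    linarith
  convert hfinal using 2

/-! ### Final arithmetic and thresholds -/

/-- The final arithmetic of the counting: four quarter-bounds. [folklore] -/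
theorem final_arith {R₀ F K₀ C₁₄ M₁ X X' Nmin W lg llg lX7 : ℝ} (hR₀ : 0 ≤ R₀) (hF : 0 ≤ F)
    (hK₀ : 0 ≤ K₀) (hC : 0 ≤ C₁₄) (hW : 0 < W) (hlg : 0 < lg)
    (hlX : 0 < lX7) (hNmin : 0 < Nmin) (hX' : X' ≤ 2 * X) (hX'0 : 0 ≤ X')
    (c1 : 4 * W * R₀ ≤ X) (c2 : 64 * F * R₀ * K₀ * C₁₄ * W * llg ≤ lg)
    (c3 : 16 * F * R₀ * K₀ * C₁₄ * W ≤ lX7) (c4 : 16 * F * M₁ * K₀ * W ≤ Nmin) :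
    R₀ + F * (2 * R₀ * K₀ * C₁₄ * (4 * llg / lg + 1 / lX7) * X' + 2 * M₁ * K₀ * X' / Nmin) ≤
      X / W := by
  rw [le_div_iff₀ hW]
  set a : ℝ := 16 * F * R₀ * K₀ * C₁₄ * W with ha
  have ha0 : 0 ≤ a := by rw [ha]; positivity
  -- term 1
  have t1 : R₀ * W ≤ X / 4 := by linarith
  -- term 2
  have t2 : F * (2 * R₀ * K₀ * C₁₄ * (4 * llg / lg) * X') * W ≤ X / 4 := by
    have e : F * (2 * R₀ * K₀ * C₁₄ * (4 * llg / lg) * X') * W = (a * llg / lg) * (X' / 2) := by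
      rw [ha]; field_simp; ring
    rw [e]
    have h1 : a * llg / lg ≤ 1 / 4 := by
      rw [div_le_iff₀ hlg]
      have : 4 * a * llg ≤ lg := by rw [ha]; linarith
      linarith
    have h2 : X' / 2 ≤ X := by linarith
    calc (a * llg / lg) * (X' / 2) ≤ (1 / 4) * X :=
          mul_le_mul h1 h2 (by positivity) (by norm_num)
      _ = X / 4 := by ring
  -- term 3
  have t3 : F * (2 * R₀ * K₀ * C₁₄ * (1 / lX7) * X') * W ≤ X / 4 := by
    have e : F * (2 * R₀ * K₀ * C₁₄ * (1 / lX7) * X') * W = (a / lX7) * (X' / 8) := by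
      rw [ha]; field_simp; ring
    rw [e]
    have h1 : a / lX7 ≤ 1 := by rw [div_le_one hlX]; exact c3
    have h2 : X' / 8 ≤ X / 4 := by linarith
    calc (a / lX7) * (X' / 8) ≤ 1 * (X / 4) := mul_le_mul h1 h2 (by positivity) (by norm_num)
      _ = X / 4 := one_mul _
  -- term 4
  have t4 : F * (2 * M₁ * K₀ * X' / Nmin) * W ≤ X / 4 := by
    have e : F * (2 * M₁ * K₀ * X' / Nmin) * W = (16 * F * M₁ * K₀ * W / Nmin) * (X' / 8) := by
      field_simp; ring
    rw [e]
    have h1 : 16 * F * M₁ * K₀ * W / Nmin ≤ 1 := by rw [div_le_one hNmin]; exact c4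
    have h2 : X' / 8 ≤ X / 4 := by linarith
    calc (16 * F * M₁ * K₀ * W / Nmin) * (X' / 8) ≤ 1 * (X / 4) :=
          mul_le_mul h1 h2 (by positivity) (by norm_num)
      _ = X / 4 := one_mul _
  have e : (R₀ + F * (2 * R₀ * K₀ * C₁₄ * (4 * llg / lg + 1 / lX7) * X' + 2 * M₁ * K₀ * X' / Nmin)) * W
      = R₀ * W + F * (2 * R₀ * K₀ * C₁₄ * (4 * llg / lg) * X') * W +
        F * (2 * R₀ * K₀ * C₁₄ * (1 / lX7) * X') * W + F * (2 * M₁ * K₀ * X' / Nmin) * W := by ring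
  rw [e]
  linarith

/-- Lower bound for a natural quotient as a real number: `⌊H/R⌋ ≥ H/R - 1`. [folklore] -/
theorem natDiv_ge (H R : ℕ) : (H : ℝ) / R - 1 ≤ ((H / R : ℕ) : ℝ) := by
  rw [← Nat.floor_div_eq_div (K := ℝ)]
  have := Nat.lt_floor_add_one ((H : ℝ) / R)
  linarith

/-- **Thresholds in `H'`.** For `H'` beyond explicit polynomial thresholds in `R₀, M₁, K₀` the
size conditions of the counting hold. [folklore] -/
theorem H_thresholds {R₀ M₁ K₀ H' : ℕ} (hR₀ : 1 ≤ R₀) (hM₁ : 1 ≤ M₁) (hK₀ : 1 ≤ K₀)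
    (hHa : R₀ * (120 * M₁ + 1) ≤ H') (hHb : R₀ * (16 * K₀ * M₁ + 1) ≤ H')
    (hHc : 16 * R₀ ^ 2 * M₁ ^ 2 * K₀ ^ 2 ≤ H') (hHd : 6 * (R₀ * M₁) ≤ H') (hHe : 4 * R₀ ≤ H') :
    120 * M₁ ≤ H' / R₀ - 1 ∧ 16 * K₀ ≤ (H' / R₀ - 1) / M₁ ∧
    (H' : ℝ) ≤ ((((H' / R₀ - 1) / M₁ : ℕ) : ℝ) / (2 * K₀)) ^ 2 ∧ 1 ≤ H' / R₀ - 1 ∧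
    (H' : ℝ) / (2 * R₀) ≤ ((H' / R₀ - 1 : ℕ) : ℝ) := by
  have hR₀R : (1 : ℝ) ≤ R₀ := by exact_mod_cast hR₀
  have hM₁R : (1 : ℝ) ≤ M₁ := by exact_mod_cast hM₁
  have hK₀R : (1 : ℝ) ≤ K₀ := by exact_mod_cast hK₀
  have hdiv : ∀ c : ℕ, R₀ * c ≤ H' → c ≤ H' / R₀ := fun c hc =>
    (Nat.le_div_iff_mul_le (by omega)).mpr (by rw [Nat.mul_comm]; exact hc)
  have h1 : 120 * M₁ ≤ H' / R₀ - 1 := by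
    have := hdiv (120 * M₁ + 1) hHa
    omega
  have h2 : 16 * K₀ ≤ (H' / R₀ - 1) / M₁ := by
    rw [Nat.le_div_iff_mul_le (by omega)]
    have := hdiv (16 * K₀ * M₁ + 1) hHb
    omega
  have hq1 : 1 ≤ H' / R₀ - 1 := le_trans (by omega) h1
  -- real lower bounds for `Nmin` and `Lmin`
  have hNmin : (H' : ℝ) / R₀ - 2 ≤ ((H' / R₀ - 1 : ℕ) : ℝ) := by
    have h := natDiv_ge H' R₀
    have hq : 1 ≤ H' / R₀ := by omega
    rw [Nat.cast_sub hq]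
    push_cast
    linarith
  have hLmin : (H' : ℝ) / (R₀ * M₁) - 3 ≤ (((H' / R₀ - 1) / M₁ : ℕ) : ℝ) := by
    have h := natDiv_ge (H' / R₀ - 1) M₁
    have hM₁0 : (0 : ℝ) < M₁ := by linarith
    have h3 : ((H' : ℝ) / R₀ - 2) / M₁ ≤ (((H' / R₀ - 1 : ℕ) : ℝ)) / M₁ :=
      div_le_div_of_nonneg_right hNmin hM₁0.le
    have h4 : ((H' : ℝ) / R₀ - 2) / M₁ = (H' : ℝ) / (R₀ * M₁) - 2 / M₁ := by
      rw [sub_div, div_div]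
    have h5 : (2 : ℝ) / M₁ ≤ 2 := div_le_self (by norm_num) hM₁R
    linarith
  have hHR : (16 : ℝ) * R₀ ^ 2 * M₁ ^ 2 * K₀ ^ 2 ≤ H' := by exact_mod_cast hHc
  have hH6 : (6 : ℝ) * (R₀ * M₁) ≤ H' := by exact_mod_cast hHd
  have hH0 : (0 : ℝ) ≤ H' := by positivity
  have h3 : (H' : ℝ) ≤ ((((H' / R₀ - 1) / M₁ : ℕ) : ℝ) / (2 * K₀)) ^ 2 := by
    have hRM : (0 : ℝ) < R₀ * M₁ := by positivity
    -- `Lmin ≥ H'/(2 R₀ M₁)`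
    have hq6 : (6 : ℝ) ≤ (H' : ℝ) / (R₀ * M₁) := by rw [le_div_iff₀ hRM]; linarith
    have hL : (H' : ℝ) / (R₀ * M₁) / 2 ≤ (((H' / R₀ - 1) / M₁ : ℕ) : ℝ) := by linarith
    have hL0 : 0 ≤ (H' : ℝ) / (R₀ * M₁) / 2 := by positivity
    have key : (H' : ℝ) ≤ ((H' : ℝ) / (R₀ * M₁) / 2 / (2 * K₀)) ^ 2 := by
      have e : ((H' : ℝ) / (R₀ * M₁) / 2 / (2 * K₀)) ^ 2 = (H' : ℝ) ^ 2 / (16 * R₀ ^ 2 * M₁ ^ 2 * K₀ ^ 2) := by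
        field_simp
        ring
      rw [e, le_div_iff₀ (by positivity)]
      calc (H' : ℝ) * (16 * R₀ ^ 2 * M₁ ^ 2 * K₀ ^ 2) ≤ (H' : ℝ) * H' :=
            mul_le_mul_of_nonneg_left hHR hH0
        _ = (H' : ℝ) ^ 2 := by ring
    calc (H' : ℝ) ≤ ((H' : ℝ) / (R₀ * M₁) / 2 / (2 * K₀)) ^ 2 := key
      _ ≤ ((((H' / R₀ - 1) / M₁ : ℕ) : ℝ) / (2 * K₀)) ^ 2 := by
          apply pow_le_pow_left₀ (by positivity)
          exact div_le_div_of_nonneg_right hL (by positivity)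
  refine ⟨h1, h2, h3, hq1, ?_⟩
  have hH4 : (4 : ℝ) * R₀ ≤ H' := by exact_mod_cast hHe
  have hR₀0 : (0 : ℝ) < R₀ := by linarith
  have hq4 : (4 : ℝ) ≤ (H' : ℝ) / R₀ := by rw [le_div_iff₀ hR₀0]; linarith
  have e : (H' : ℝ) / (2 * R₀) = (H' : ℝ) / R₀ / 2 := by rw [div_div, mul_comm]
  rw [e]
  linarith

/-- **Thresholds in `X`.** [folklore] -/
theorem X_thresholds {E₃ E₄ W : ℝ} {R₀ H' X : ℕ}
    (hX : ⌈Real.exp (max E₃ E₄)⌉₊ + R₀ * (H' + 2) + ⌈4 * W * R₀⌉₊ + 2 ≤ X) :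
    2 ≤ X ∧ R₀ * (H' + 2) ≤ X ∧ 4 * W * R₀ ≤ (X : ℝ) ∧ E₃ ≤ Real.log X ∧ E₄ ≤ Real.log X := by
  have hX2 : 2 ≤ X := by omega
  have hXR : (0 : ℝ) < X := by exact_mod_cast (show 0 < X by omega)
  have hexp : Real.exp (max E₃ E₄) ≤ X := by
    have h1 := Nat.le_ceil (Real.exp (max E₃ E₄))
    have h2 : (⌈Real.exp (max E₃ E₄)⌉₊ : ℝ) ≤ X := by exact_mod_cast (show ⌈Real.exp (max E₃ E₄)⌉₊ ≤ X by omega)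
    linarith
  have hlog : max E₃ E₄ ≤ Real.log X := by
    rw [Real.le_log_iff_exp_le hXR]; exact hexp
  refine ⟨hX2, by omega, ?_, le_trans (le_max_left _ _) hlog, le_trans (le_max_right _ _) hlog⟩
  have h1 := Nat.le_ceil (4 * W * R₀)
  have h2 : (⌈4 * W * (R₀ : ℝ)⌉₊ : ℝ) ≤ X := by exact_mod_cast (show ⌈4 * W * (R₀ : ℝ)⌉₊ ≤ X by omega)
  linarith

/-- From `a^n ≤ L` with `a ≥ 0`: `a ≤ L^{1/n}`. [folklore] -/
theorem le_rpow_inv_of_pow_le {a L : ℝ} {n : ℕ} (ha : 0 ≤ a) (hn : n ≠ 0) (h : a ^ n ≤ L) :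
    a ≤ L ^ ((n : ℝ)⁻¹) := by
  have hL : 0 ≤ L := le_trans (by positivity) h
  calc a = (a ^ n) ^ ((n : ℝ)⁻¹) := (Real.pow_rpow_inv_natCast ha hn).symm
    _ ≤ L ^ ((n : ℝ)⁻¹) := Real.rpow_le_rpow (by positivity) h (by positivity)

/-- **Uniform per-tuple bound** (`perTuple_card_le` + `rate_le_uniform` + `N' ≥ Nmin`).
[cite: Teravainen2024, §5.4 (the exceptional set of Proposition 5.4), for g = λ] -/
theorem perTuple_uniform {C₁₄ : ℝ} (hC₁₄ : 0 ≤ C₁₄)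
    (hXIV : ∀ (m b H X : ℕ), 1 ≤ m → b < m → 16 * m ≤ H → H ≤ X →
      (m : ℝ) * Real.log H ^ (5 : ℝ) ≤ Real.log X ^ (1 / 125 : ℝ) →
      ∑ y ∈ Finset.range X, ‖∑ n ∈ (Finset.Ioc y (y + H)).filter (fun n => n % m = b),
          (ArithmeticFunction.liouville : ArithmeticFunction ℂ) n‖ ≤
        C₁₄ * (Real.log (Real.log H) / Real.log (H / (2 * m)) + 1 / Real.log X ^ (1 / 700 : ℝ)) *
          H * X + X)
    {R₀ K₀ H' X X' M₁ r N' s q j b : ℕ} (hr1 : 1 ≤ r) (hrR : r ≤ R₀) (hsr : s < r) (hq1 : 1 ≤ q)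
    (hqK : q ≤ K₀) (hj : j < M₁) (hb : b < r * q) (hN'1 : H' / r - 1 ≤ N') (hN'2 : N' ≤ H' / r + 1)
    (hM₁ : 1 ≤ M₁) (hLK : 16 * K₀ ≤ (H' / R₀ - 1) / M₁)
    (hsq : (H' : ℝ) ≤ ((((H' / R₀ - 1) / M₁ : ℕ) : ℝ) / (2 * K₀)) ^ 2)
    (hH'R : R₀ + 1 ≤ H') (hH'8 : 8 ≤ H') (hNmin1 : 1 ≤ H' / R₀ - 1)
    (hX' : X' = X + R₀ * (H' + 2)) (hX2 : 2 ≤ X)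
    (hlev : ((R₀ * K₀ : ℕ) : ℝ) * Real.log ((R₀ * (H' + 1) : ℕ) : ℝ) ^ (5 : ℝ) ≤
      Real.log X ^ (1 / 125 : ℝ)) :
    (#(((Finset.Icc 1 X).filter fun y => R₀ < y).filter fun y =>
        (N' : ℝ) / (2 * M₁ * q) ≤
          ‖∑ n ∈ (Finset.Ioc (y - s + r * (j * (N' / M₁))) (y - s + r * (j * (N' / M₁)) +
              r * (N' / M₁))).filter (fun n => n % (r * q) = b),
            (ArithmeticFunction.liouville : ArithmeticFunction ℂ) n‖) : ℝ)
      ≤ 2 * R₀ * K₀ * C₁₄ * (4 * Real.log (Real.log H') / Real.log H' + 1 / Real.log X ^ (1 / 700 : ℝ)) * X' +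
        2 * M₁ * K₀ * X' / ((H' / R₀ - 1 : ℕ) : ℝ) := by
  have hN'min : H' / R₀ - 1 ≤ N' := by
    have : H' / R₀ ≤ H' / r := Nat.div_le_div_left hrR (by omega)
    omega
  have hL : 16 * K₀ ≤ N' / M₁ := hLK.trans (Nat.div_le_div_right hN'min)
  have hper := perTuple_card_le hC₁₄ hXIV hr1 hrR hsr hq1 hqK hj hb hN'2 rfl hM₁ hL hX' hX2 hlev
  refine hper.trans ?_
  have hK₀1 : 1 ≤ K₀ := hq1.trans hqK
  have hL16 : 16 ≤ N' / M₁ := le_trans (by omega) hL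
  have hrL : r * (N' / M₁) ≤ R₀ * (H' + 1) := by
    have h1 : N' / M₁ ≤ N' := Nat.div_le_self _ _
    have h2 : r * N' ≤ r * (H' / r + 1) := Nat.mul_le_mul_left r hN'2
    have h3 : r * (H' / r) ≤ H' := Nat.mul_div_le H' r
    have h4 : r * (N' / M₁) ≤ r * N' := Nat.mul_le_mul_left r h1
    have h5 : r * (H' / r + 1) = r * (H' / r) + r := by ring
    nlinarith
  have hXX' : X ≤ X' := by rw [hX']; omega
  have hrate := rate_le_uniform (X' := X') hr1 hq1 hqK (Nat.div_le_div_right hN'min) hrL hH'R hH'8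
    hL16 hsq hX2 hXX'
  have hN'R : ((H' / R₀ - 1 : ℕ) : ℝ) ≤ N' := by exact_mod_cast hN'min
  have hNminR : (1 : ℝ) ≤ ((H' / R₀ - 1 : ℕ) : ℝ) := by exact_mod_cast hNmin1
  have hA : 2 * (R₀ : ℝ) * K₀ * C₁₄ * (Real.log (Real.log ((r * (N' / M₁) : ℕ) : ℝ)) /
      Real.log (((r * (N' / M₁) : ℕ) : ℝ) / (2 * ((r * q : ℕ) : ℝ))) + 1 / Real.log X' ^ (1 / 700 : ℝ)) * X'
      ≤ 2 * R₀ * K₀ * C₁₄ * (4 * Real.log (Real.log H') / Real.log H' + 1 / Real.log X ^ (1 / 700 : ℝ)) * X' := by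
    apply mul_le_mul_of_nonneg_right _ (by positivity)
    exact mul_le_mul_of_nonneg_left hrate (by positivity)
  have hB : 2 * (M₁ : ℝ) * K₀ * X' / N' ≤ 2 * M₁ * K₀ * X' / ((H' / R₀ - 1 : ℕ) : ℝ) :=
    div_le_div_of_nonneg_left (by positivity) (by linarith) hN'R
  exact add_le_add hA hB

/-! ### Proposition 5.4 for `λ`: the core statement -/

open scoped Classical in
/-- **Teräväinen 2024, Proposition 5.4 for `g = λ` (core, start-point form).** For every `k ≥ 1`,
every bound `R₀ ≥ 1` on the progression modulus and every exponent `B`: for `H' ≥ H₀(k, R₀, B)`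
and `X ≥ X₀(k, R₀, B, H')`, the number of starting points `1 ≤ y ≤ X` for which SOME real
polynomial phase `P` of degree `≤ k` and SOME progression `n ≡ a (mod r)`, `1 ≤ r ≤ R₀`, give
`|∑_{y<n≤y+H', n≡a (r)} λ(n) e(-P(n))| > (1 - 1/30) #{y<n≤y+H' : n≡a (r)}` is at most
`X/(log log H')^B`. (The paper's statement has `sup_P` inside and the exceptional set
`≪ X/log log H`; `δ = 1/30` is admissible for `λ` because `μ_{q}` with `q = 2` gives the Jensen
bound `2/π < 1`.) The proof is §5.4: Case 2 (minor arcs) is impossible pointwise by the Weyl-sum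
dichotomy (Green–Tao), Erdős–Turán and Lemma 5.7; Case 1 (major arcs) reduces by (5.17)–(5.18)
to sums of `λ` along progressions in short intervals, which are small for all but few starting
points by the Matomäki–Radziwiłł theorem for `λχ` ((5.19)), and a union bound over the
quantised parameters. [cite: Teravainen2024, Proposition 5.4 and §5.4, for g = λ] -/
theorem liouville_prop54_core (k : ℕ) (hk : 1 ≤ k) (R₀ B : ℕ) (hR₀ : 1 ≤ R₀) :
    ∃ H₀ : ℕ, ∀ H' : ℕ, H₀ ≤ H' → ∃ X₀ : ℕ, ∀ X : ℕ, X₀ ≤ X →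
      (#((Finset.Icc 1 X).filter fun y => ∃ P : ℝ[X], P.natDegree ≤ k ∧ ∃ a r : ℕ, 1 ≤ r ∧ r ≤ R₀ ∧
          (1 - 1 / 30) * #((Finset.Ioc y (y + H')).filter fun n => n % r = a % r) <
            ‖∑ n ∈ (Finset.Ioc y (y + H')).filter (fun n => n % r = a % r),
              (ArithmeticFunction.liouville : ArithmeticFunction ℂ) n * VdC.e (-P.eval (n : ℝ))‖) : ℝ)
        ≤ X / Real.log (Real.log H') ^ B := by
  obtain ⟨A, C, hC, hXIII⟩ := weyl_sums_small_of_minorArc k hk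
  obtain ⟨C₁₄, hC₁₄0, hXIV⟩ := sum_norm_liouville_progression_shortSum_le
  -- constants
  have hK₁1 : 1 ≤ C * (8 / (1e-10 : ℝ) ^ 2) ^ A := by
    have : (1 : ℝ) ≤ (8 / (1e-10 : ℝ) ^ 2) ^ A := one_le_pow₀ (by norm_num)
    nlinarith
  obtain ⟨K₀, hK₀, hK₀1⟩ : ∃ K₀ : ℕ, (199999 : ℝ) * (C * (8 / (1e-10 : ℝ) ^ 2) ^ A) ≤ K₀ ∧ 1 ≤ K₀ :=
    ⟨⌈(199999 : ℝ) * (C * (8 / (1e-10 : ℝ) ^ 2) ^ A)⌉₊, Nat.le_ceil _, by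
      have : (1 : ℝ) ≤ ⌈(199999 : ℝ) * (C * (8 / (1e-10 : ℝ) ^ 2) ^ A)⌉₊ :=
        le_trans (by nlinarith) (Nat.le_ceil _)
      exact_mod_cast this⟩
  obtain ⟨M₁, hM₁big, hM₁⟩ : ∃ M₁ : ℕ,
      240 * Real.pi * (k : ℝ) ^ 2 * (C * (8 / (1e-10 : ℝ) ^ 2) ^ A) ≤ M₁ ∧ 1 ≤ M₁ :=
    ⟨⌈240 * Real.pi * (k : ℝ) ^ 2 * (C * (8 / (1e-10 : ℝ) ^ 2) ^ A)⌉₊ + 1, by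
      have := Nat.le_ceil (240 * Real.pi * (k : ℝ) ^ 2 * (C * (8 / (1e-10 : ℝ) ^ 2) ^ A))
      push_cast; linarith, by omega⟩
  have hF0 : 0 ≤ 3 * (R₀ : ℝ) ^ 3 * (K₀ : ℝ) ^ 2 * M₁ := by positivity
  -- growth thresholds
  obtain ⟨H₁, hH₁⟩ := exists_loglog_pow_le_log (64 * (3 * (R₀ : ℝ) ^ 3 * (K₀ : ℝ) ^ 2 * M₁) * R₀ * K₀ * C₁₄) (B + 1)
  obtain ⟨H₂, hH₂⟩ := exists_loglog_pow_le_log (64 * (3 * (R₀ : ℝ) ^ 3 * (K₀ : ℝ) ^ 2 * M₁) * M₁ * K₀ * R₀) B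
  refine ⟨H₁ + H₂ + R₀ * (120 * M₁ + 1) + R₀ * (16 * K₀ * M₁ + 1) + 16 * R₀ ^ 2 * M₁ ^ 2 * K₀ ^ 2 +
    6 * (R₀ * M₁) + 4 * R₀ + 16, fun H' hH' => ?_⟩
  have hH'1 : H₁ ≤ H' := by omega
  have hH'2 : H₂ ≤ H' := by omega
  obtain ⟨hNmin, hLK, hsq, hNmin1, hNminR⟩ :=
    H_thresholds (H' := H') hR₀ hM₁ hK₀1 (by omega) (by omega) (by omega) (by omega) (by omega)
  have hH'R : R₀ + 1 ≤ H' := by omega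
  have hH'8 : 8 ≤ H' := by omega
  have hH'R16 : (16 : ℝ) ≤ H' := by exact_mod_cast (show 16 ≤ H' by omega)
  have hlogH' : 1 < Real.log H' := by
    rw [Real.lt_log_iff_exp_lt (by linarith)]; linarith [Real.exp_one_lt_three]
  have hllg0 : 0 < Real.log (Real.log H') := Real.log_pos hlogH'
  have hW0 : 0 < Real.log (Real.log H') ^ B := by positivity
  -- thresholds in `X`
  refine ⟨⌈Real.exp (max
      ((16 * (3 * (R₀ : ℝ) ^ 3 * (K₀ : ℝ) ^ 2 * M₁) * R₀ * K₀ * C₁₄ * Real.log (Real.log H') ^ B) ^ (700 : ℕ))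
      ((((R₀ * K₀ : ℕ) : ℝ) * Real.log ((R₀ * (H' + 1) : ℕ) : ℝ) ^ (5 : ℝ)) ^ (125 : ℕ)))⌉₊ +
    R₀ * (H' + 2) + ⌈4 * Real.log (Real.log H') ^ B * R₀⌉₊ + 2, fun X hX => ?_⟩
  obtain ⟨hX2, hXR, hc1, hE₃X, hE₄X⟩ := X_thresholds hX
  have hlogX : 0 < Real.log X := Real.log_pos (by exact_mod_cast (show 1 < X by omega))
  -- the level condition and the `X`-rate condition
  have hlev : ((R₀ * K₀ : ℕ) : ℝ) * Real.log ((R₀ * (H' + 1) : ℕ) : ℝ) ^ (5 : ℝ) ≤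
      Real.log X ^ (1 / 125 : ℝ) := by
    have h0 : 0 ≤ ((R₀ * K₀ : ℕ) : ℝ) * Real.log ((R₀ * (H' + 1) : ℕ) : ℝ) ^ (5 : ℝ) := by
      have : (1 : ℝ) ≤ ((R₀ * (H' + 1) : ℕ) : ℝ) := by
        exact_mod_cast (show 1 ≤ R₀ * (H' + 1) by nlinarith)
      have := Real.log_nonneg this
      positivity
    have := le_rpow_inv_of_pow_le h0 (by norm_num : (125 : ℕ) ≠ 0) hE₄X
    rwa [show (((125 : ℕ) : ℝ)⁻¹) = (1 / 125 : ℝ) by norm_num] at this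
  have hlX7 : 16 * (3 * (R₀ : ℝ) ^ 3 * (K₀ : ℝ) ^ 2 * M₁) * R₀ * K₀ * C₁₄ * Real.log (Real.log H') ^ B ≤
      Real.log X ^ (1 / 700 : ℝ) := by
    have h0 : 0 ≤ 16 * (3 * (R₀ : ℝ) ^ 3 * (K₀ : ℝ) ^ 2 * M₁) * R₀ * K₀ * C₁₄ * Real.log (Real.log H') ^ B := by
      positivity
    have := le_rpow_inv_of_pow_le h0 (by norm_num : (700 : ℕ) ≠ 0) hE₃X
    rwa [show (((700 : ℕ) : ℝ)⁻¹) = (1 / 700 : ℝ) by norm_num] at this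
  -- the uniform per-tuple bound and the count
  have hρ0 : 0 ≤ 4 * Real.log (Real.log H') / Real.log H' + 1 / Real.log X ^ (1 / 700 : ℝ) := by
    positivity
  have hNminR1 : (1 : ℝ) ≤ ((H' / R₀ - 1 : ℕ) : ℝ) := by exact_mod_cast hNmin1
  have hU0 : 0 ≤ 2 * R₀ * K₀ * C₁₄ * (4 * Real.log (Real.log H') / Real.log H' + 1 / Real.log X ^ (1 / 700 : ℝ)) *
      ((X + R₀ * (H' + 2) : ℕ) : ℝ) + 2 * M₁ * K₀ * ((X + R₀ * (H' + 2) : ℕ) : ℝ) / ((H' / R₀ - 1 : ℕ) : ℝ) := by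
    positivity
  have hcount := card_bad_le_of_perTuple hC hXIII (X := X) hM₁ hM₁big hNmin hK₀ hU0
    (fun r N' s q j b hr1 hrR hN' hs hq1 hqK hj hb =>
      perTuple_uniform hC₁₄0 hXIV hr1 hrR hs hq1 hqK hj hb (Finset.mem_Icc.mp hN').1
        (Finset.mem_Icc.mp hN').2 hM₁ hLK hsq hH'R hH'8 hNmin1 rfl hX2 hlev)
  refine hcount.trans ?_
  -- final arithmetic
  have hX'2 : (((X + R₀ * (H' + 2) : ℕ)) : ℝ) ≤ 2 * X := by
    have : X + R₀ * (H' + 2) ≤ 2 * X := by omega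
    exact_mod_cast this
  have c2 : 64 * (3 * (R₀ : ℝ) ^ 3 * (K₀ : ℝ) ^ 2 * M₁) * R₀ * K₀ * C₁₄ * Real.log (Real.log H') ^ B *
      Real.log (Real.log H') ≤ Real.log H' := by
    have h := hH₁ H' hH'1
    calc 64 * (3 * (R₀ : ℝ) ^ 3 * (K₀ : ℝ) ^ 2 * M₁) * R₀ * K₀ * C₁₄ * Real.log (Real.log H') ^ B *
          Real.log (Real.log H')
        = 64 * (3 * (R₀ : ℝ) ^ 3 * (K₀ : ℝ) ^ 2 * M₁) * R₀ * K₀ * C₁₄ *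
            Real.log (Real.log H') ^ (B + 1) := by rw [pow_succ]; ring
      _ ≤ Real.log H' := h
  have c4 : 16 * (3 * (R₀ : ℝ) ^ 3 * (K₀ : ℝ) ^ 2 * M₁) * M₁ * K₀ * Real.log (Real.log H') ^ B ≤
      ((H' / R₀ - 1 : ℕ) : ℝ) := by
    have h1 := hH₂ H' hH'2
    have h2 : Real.log H' ≤ H' := (Real.log_le_sub_one_of_pos (by linarith)).trans (by linarith)
    have hR₀R : (1 : ℝ) ≤ R₀ := by exact_mod_cast hR₀
    have h3 : 16 * (3 * (R₀ : ℝ) ^ 3 * (K₀ : ℝ) ^ 2 * M₁) * M₁ * K₀ * Real.log (Real.log H') ^ B * (4 * R₀) ≤ H' := by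
      calc 16 * (3 * (R₀ : ℝ) ^ 3 * (K₀ : ℝ) ^ 2 * M₁) * M₁ * K₀ * Real.log (Real.log H') ^ B * (4 * R₀)
          = 64 * (3 * (R₀ : ℝ) ^ 3 * (K₀ : ℝ) ^ 2 * M₁) * M₁ * K₀ * R₀ * Real.log (Real.log H') ^ B := by ring
        _ ≤ Real.log H' := h1
        _ ≤ H' := h2
    have h4 : 16 * (3 * (R₀ : ℝ) ^ 3 * (K₀ : ℝ) ^ 2 * M₁) * M₁ * K₀ * Real.log (Real.log H') ^ B ≤
        (H' : ℝ) / (4 * R₀) := by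
      rw [le_div_iff₀ (by positivity)]; exact h3
    have h5 : (H' : ℝ) / (4 * R₀) ≤ (H' : ℝ) / (2 * R₀) :=
      div_le_div_of_nonneg_left (by positivity) (by positivity) (by linarith)
    linarith
  exact final_arith (by positivity) hF0 (by positivity) hC₁₄0 hW0 (by linarith)
    (Real.rpow_pos_of_pos hlogX _) (by linarith) hX'2 (by positivity) hc1 c2 hlX7 c4

end Teravainen2024

end Literature.NumberTheory.Sieve
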